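import Literature.Geometry.Symplectic.SublevelSteinReebLift
import Mathlib.LinearAlgebra.FreeModule.Finite.Matrix
import HarnessLib

/-!
# The Reeb field of a flat sublevel Stein domain is the `J₀`-rotated Levi gradient

Topic `Literature/Geometry/Symplectic`; a proofs-only continuation (no definition, no named fact)
of `SublevelSteinReebLift.lean`.  For a compact regular sublevel set `W = {Ψ ≤ c} ⊂ ℝ⁴` with
the Stein structure `(J₀|, Ψ|)` (`exists_steinStructure_sublevel_of_levi_pos`: the flat Levi
form `h_z(u, v) = D²Ψ_z(u, v) + D²Ψ_z(J₀u, J₀v)` positive definite on `W`) and any boundary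
datum `b`:

* `exists_leviGradient` — linear algebra: for a positive definite `J₀`-symmetrised bilinear
  form `h(u, v) = A(u, v) + A(J₀u, J₀v)` on `ℝ⁴` and a functional `ℓ` there is `G` with
  `h(G, ·) = ℓ` (injective endomorphism of equal finite dimension);
* `exists_reebField_sublevel` — **the ambient field `V = J₀ G`, `G = ∇^{h}Ψ` the Levi gradient
  of `Ψ` (`h(G, ·) = DΨ`), is tangent to the level, `ω_Ψ`-orthogonal to it and positive for
  `-d^ℂΨ`**: `DΨ(J₀G) = h(G, J₀G) = 0`, `D²Ψ(J₀G, J₀w) = -D²Ψ(w, G)` for `w ∈ ker DΨ`,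
  `-DΨ(J₀J₀G) = DΨ(G) = h(G, G) > 0` (`G ≠ 0` on the regular level); hence
  (`reeb_clauses_of_ambient`) its lift `R` to `b.carrier` satisfies **`β(R) > 0` and
  `ι_R dβ = 0`** for the canonical boundary contact form `β = b.incl^*(-d^ℂφ)` — the first two
  hypotheses of the Reeb criterion `SteinStructure.isGirouxForm_boundaryContactForm_of_reebField`
  (`LefschetzSteinOpenBookReeb.lean`; Etnyre 2006, Lemma 3.3), for EVERY such domain.  What is
  left to a user of the criterion is transversality to the pages (`dθ(R) > 0`, i.e.
  `Im (Dw(J₀G)/w) = Re (Dw(G)/w) > 0` for an open book with fibration `w/‖w‖`), the binding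
  clauses and the orientation clause.

## References

* J. B. Etnyre, *Lectures on open book decompositions and contact structures*, Clay Math.
  Proc. 5 (2006), Lemma 3.3. [Etnyre2006]
* K. Cieliebak, Ya. Eliashberg, *From Stein to Weinstein and Back*, AMS Coll. Publ. 59 (2012),
  Ch. 2 (the Levi form, `J`-convex hypersurfaces and their Reeb fields). [CieliebakEliashberg2012]
-/

noncomputable section

open scoped Manifold ContDiff Topology
open Set Function Module

namespace Literature.Geometry.Symplectic

open Literature.Topology.FourManifolds Literature.Geometry.Kaehler

/-! ### Linear algebra: the Levi gradient -/

/-- **Riesz for a positive definite `J₀`-symmetrised form.**  If `h(u, v) = A(u, v) + A(J₀u, J₀v)`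
satisfies `h(u, u) > 0` for `u ≠ 0`, then every functional `ℓ` on `ℝ⁴` is `h(G, ·)` for some
`G`. [folklore] -/
theorem exists_leviGradient (J₀ : EuclideanSpace ℝ (Fin 4) →L[ℝ] EuclideanSpace ℝ (Fin 4))
    (A : EuclideanSpace ℝ (Fin 4) →L[ℝ] EuclideanSpace ℝ (Fin 4) →L[ℝ] ℝ)
    (hpos : ∀ u, u ≠ 0 → 0 < A u u + A (J₀ u) (J₀ u)) (ℓ : EuclideanSpace ℝ (Fin 4) →L[ℝ] ℝ) :
    ∃ G : EuclideanSpace ℝ (Fin 4), ∀ v, A G v + A (J₀ G) (J₀ v) = ℓ v := by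
  set f : EuclideanSpace ℝ (Fin 4) →ₗ[ℝ] (EuclideanSpace ℝ (Fin 4) →ₗ[ℝ] ℝ) :=
    LinearMap.mk₂ ℝ (fun u v => A u v + A (J₀ u) (J₀ v))
      (fun m₁ m₂ n => by simp only [map_add, add_apply]; ring)
      (fun c m n => by
        simp only [map_smul, FunLike.coe_smul, Pi.smul_apply, smul_eq_mul]; ring)
      (fun m n₁ n₂ => by simp only [map_add]; ring)
      (fun c m n => by simp only [map_smul, smul_eq_mul]; ring) with hf
  have hfa : ∀ u v, f u v = A u v + A (J₀ u) (J₀ v) := fun u v => rfl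
  have hinj : Function.Injective f := by
    intro u₁ u₂ h12
    by_contra hne
    have hsub : u₁ - u₂ ≠ 0 := sub_ne_zero.2 hne
    have hp := hpos _ hsub
    have h0 : f (u₁ - u₂) (u₁ - u₂) = 0 := by
      have : f (u₁ - u₂) = 0 := by rw [map_sub, h12, sub_self]
      rw [this, LinearMap.zero_apply]
    rw [hfa] at h0
    linarith
  have hdim : finrank ℝ (EuclideanSpace ℝ (Fin 4)) =
      finrank ℝ (EuclideanSpace ℝ (Fin 4) →ₗ[ℝ] ℝ) := by
    rw [Module.finrank_linearMap_self]
  have hsurj := (LinearMap.injective_iff_surjective_of_finrank_eq_finrank hdim).1 hinj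
  obtain ⟨G, hG⟩ := hsurj (ℓ : EuclideanSpace ℝ (Fin 4) →ₗ[ℝ] ℝ)
  refine ⟨G, fun v => ?_⟩
  have := LinearMap.congr_fun hG v
  rw [hfa] at this
  exact this

/-! ### The Reeb field of `{Ψ ≤ c}` -/

variable {Ψ : EuclideanSpace ℝ (Fin 4) → ℝ} {c : ℝ} {h : IsRegularLevel (𝓡 4) Ψ c}
  [CompactSpace (RegularSublevel h)]
  {J₀ : EuclideanSpace ℝ (Fin 4) →L[ℝ] EuclideanSpace ℝ (Fin 4)}
  {S : SteinStructure (RegularSublevel h)}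

omit [CompactSpace (RegularSublevel h)] in
/-- The defining function has non-zero derivative at the points of the level. [folklore] -/
theorem fderiv_ne_zero_of_eq_level (h : IsRegularLevel (𝓡 4) Ψ c) {z : EuclideanSpace ℝ (Fin 4)}
    (hz : Ψ z = c) : fderiv ℝ Ψ z ≠ 0 := by
  intro h0
  apply h.not_isMCriticalPt hz
  show mfderiv (𝓡 4) 𝓘(ℝ, ℝ) Ψ z = 0
  rw [mfderiv_eq_fderiv, h0]
  rfl

/-- **The Reeb field of a flat sublevel Stein domain.**  Let `S = (J₀|, Ψ|)` be the sublevel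
Stein structure on `W = {Ψ ≤ c}` (`S.φ = Ψ ∘ incl`, `S.J = J₀` read through `Dincl`), `J₀² = -1`,
with the flat Levi form of `Ψ` positive definite on `W`, and `b` a boundary datum.  Then there
are the Levi gradient `G` (`h_z(G z, v) = DΨ_z(v)` at the points of the level) and a field `R`
on `b.carrier` lifting `V = J₀ G` (`Dincl (d(b.incl) (R y)) = J₀ (G (ι y))`) such that
`β(R) > 0` and `ι_R dβ = 0` for the canonical boundary contact form `β = b.incl^*(-d^ℂφ)`.
[cite: Etnyre2006, Lemma 3.3] -/
theorem exists_reebField_sublevel (hSφ : S.φ = sublevelPhi h) (hSJ : S.J = sublevelJ h J₀)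
    (hJ : ∀ v, J₀ (J₀ v) = -v)
    (hpos : ∀ z, Ψ z = c → ∀ u : EuclideanSpace ℝ (Fin 4), u ≠ 0 →
      0 < fderiv ℝ (fderiv ℝ Ψ) z u u + fderiv ℝ (fderiv ℝ Ψ) z (J₀ u) (J₀ u))
    (b : BoundaryData (𝓡∂ 4) (RegularSublevel h) (𝓡 3)) :
    ∃ (G : EuclideanSpace ℝ (Fin 4) → EuclideanSpace ℝ (Fin 4))
      (R : b.carrier → EuclideanSpace ℝ (Fin 3)),
      (∀ z, Ψ z = c → ∀ v, fderiv ℝ (fderiv ℝ Ψ) z (G z) v +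
        fderiv ℝ (fderiv ℝ Ψ) z (J₀ (G z)) (J₀ v) = fderiv ℝ Ψ z v) ∧
      (∀ z, Ψ z = c → G z ≠ 0) ∧
      (∀ y, inclDeriv h (b.incl y) (mfderiv (𝓡 3) (𝓡∂ 4) b.incl y (R y)) =
        J₀ (G (RegularSublevel.incl h (b.incl y)))) ∧
      (∀ y, 0 < S.boundaryContactForm b y ![R y]) ∧
      ∀ (y : b.carrier) (z : EuclideanSpace ℝ (Fin 3)),
        mextDeriv (S.boundaryContactForm b) y ![R y, z] = 0 := by
  classical
  have hΨ : ContDiff ℝ ∞ Ψ := contDiff_of_isRegularLevel h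
  -- the Levi gradient on the level (junk elsewhere)
  have hex : ∀ z, Ψ z = c → ∃ G : EuclideanSpace ℝ (Fin 4), ∀ v,
      fderiv ℝ (fderiv ℝ Ψ) z G v + fderiv ℝ (fderiv ℝ Ψ) z (J₀ G) (J₀ v) = fderiv ℝ Ψ z v :=
    fun z hz => exists_leviGradient J₀ (fderiv ℝ (fderiv ℝ Ψ) z) (hpos z hz) (fderiv ℝ Ψ z)
  set G : EuclideanSpace ℝ (Fin 4) → EuclideanSpace ℝ (Fin 4) := fun z =>
    if hz : Ψ z = c then Classical.choose (hex z hz) else 0 with hGdef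
  have hG : ∀ z, Ψ z = c → ∀ v, fderiv ℝ (fderiv ℝ Ψ) z (G z) v +
      fderiv ℝ (fderiv ℝ Ψ) z (J₀ (G z)) (J₀ v) = fderiv ℝ Ψ z v := by
    intro z hz v
    have : G z = Classical.choose (hex z hz) := by simp [hGdef, hz]
    rw [this]
    exact Classical.choose_spec (hex z hz) v
  -- symmetry of `D²Ψ`
  have hsymm : ∀ z u v, fderiv ℝ (fderiv ℝ Ψ) z u v = fderiv ℝ (fderiv ℝ Ψ) z v u :=
    fun z u v => ((hΨ.of_le (by norm_cast)).contDiffAt (x := z)).isSymmSndFDerivAt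
      (n := 2) (by simp) u v
  -- `G ≠ 0` on the level
  have hG0 : ∀ z, Ψ z = c → G z ≠ 0 := by
    intro z hz hG0
    apply fderiv_ne_zero_of_eq_level h hz
    ext v
    have := hG z hz v
    rw [hG0, map_zero, map_zero, zero_apply, map_zero,
      zero_apply, zero_add] at this
    exact this.symm
  -- boundary points lie on the level
  have hlev : ∀ y : b.carrier, Ψ (RegularSublevel.incl h (b.incl y)) = c := fun y =>
    (isBoundaryPoint_iff_sublevelPhi_eq h (b.incl y)).1 (b.incl_mem_boundary y)
  -- the three ambient conditions for `V = J₀ G`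
  set V : EuclideanSpace ℝ (Fin 4) → EuclideanSpace ℝ (Fin 4) := fun z => J₀ (G z) with hVdef
  have hVt : ∀ y : b.carrier, fderiv ℝ Ψ (RegularSublevel.incl h (b.incl y))
      (V (RegularSublevel.incl h (b.incl y))) = 0 := by
    intro y
    set z := RegularSublevel.incl h (b.incl y)
    have h1 := hG z (hlev y) (J₀ (G z))
    rw [hJ, map_neg, hsymm z (J₀ (G z)) (G z)] at h1
    simp only [hVdef]
    linarith
  have hVpos : ∀ y : b.carrier, 0 < -(fderiv ℝ Ψ (RegularSublevel.incl h (b.incl y))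
      (J₀ (V (RegularSublevel.incl h (b.incl y))))) := by
    intro y
    set z := RegularSublevel.incl h (b.incl y)
    have h1 := hG z (hlev y) (G z)
    simp only [hVdef]
    rw [hJ, map_neg, neg_neg, ← h1]
    exact hpos z (hlev y) _ (hG0 z (hlev y))
  have hVker : ∀ (y : b.carrier) (w : EuclideanSpace ℝ (Fin 4)),
      fderiv ℝ Ψ (RegularSublevel.incl h (b.incl y)) w = 0 →
      fderiv ℝ (fderiv ℝ Ψ) (RegularSublevel.incl h (b.incl y))
          (V (RegularSublevel.incl h (b.incl y))) (J₀ w) =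
        fderiv ℝ (fderiv ℝ Ψ) (RegularSublevel.incl h (b.incl y)) w
          (J₀ (V (RegularSublevel.incl h (b.incl y)))) := by
    intro y w hw
    set z := RegularSublevel.incl h (b.incl y)
    have h1 := hG z (hlev y) w
    rw [hw, hsymm z (G z) w] at h1
    simp only [hVdef]
    rw [hJ, map_neg]
    linarith
  obtain ⟨R, hR, hα, hd⟩ := reeb_clauses_of_ambient b hSφ hSJ V hVt hVpos hVker
  exact ⟨G, R, hG, hG0, hR, hα, hd⟩

end Literature.Geometry.Symplectic

end
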